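import Mathlib
import HarnessLib

/-!
# Denominators of the binomial series `(1 + u)^{1/N}` (CDT §2.1)

`Literature/RingTheory/Binomial/BinomialSeriesRootDenominators.lean`. Everything here is PROVED
(no definition, no named fact). In the proof of their auxiliary construction (Lemma 2.1.1),
F. Calegari, V. Dimitrov, Y. Tang, *The unbounded denominators conjecture* (J. Amer. Math. Soc.
**38** (2025), 627–702; arXiv:2109.09040), §2.1, use: "the binomial expansion gives
`(1 + u)^{1/N} = ∑_{n ≥ 0} binom(1/N, n) uⁿ ∈ ℤ⟦u/N²⟧`, by a simple denominator estimate", i.e.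
`N^{2n} binom(1/N, n) ∈ ℤ` for all `n`. Since `binom(1/N, n) = ∏_{j<n}(1 − jN) / (Nⁿ n!)`, this is
the divisibility

  `n! ∣ Nⁿ ∏_{j<n} (1 − j N)`  (`factorial_dvd_pow_mul_prod_one_sub_mul`),

proved prime by prime: for `p ∣ N`, `v_p(n!) < n ≤ v_p(Nⁿ)` (Legendre; Mathlib's
`padicValNat_factorial_lt_of_ne_zero`); for `p ∤ N`, with
`a N ≡ 1 (mod pᵏ)`, `∏_{j<n} (1 − jN) ≡ Nⁿ ∏_{j<n} (a − j) = Nⁿ n! binom(a, n) ≡ 0 (mod pᵏ)`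
whenever `pᵏ ∣ n!`. Consequences: `N^{2n} binom(1/N, n) ∈ ℤ` (`isInt_pow_mul_choose_inv`) and the
power-series form `(1 + N² u)^{1/N} ∈ ℤ⟦u⟧` for Mathlib's `PowerSeries.binomialSeries`
(`binomialSeries_inv_rescale_mem_range`).

## References

* [CalegariDimitrovTang2025] F. Calegari, V. Dimitrov, Y. Tang, The unbounded denominators
  conjecture, J. Amer. Math. Soc. 38 (2025), no. 3, 627–702, §2.1, proof of Lemma 2.1.1;
  arXiv:2109.09040.
-/

noncomputable section

open Finset

namespace Literature.RingTheory.Binomial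

/-! ### 1. The divisibility `n! ∣ Nⁿ ∏_{j<n} (1 − jN)` -/

/-- For `a ∈ ℤ`, `n!` divides `∏_{j<n} (a − j)` (`= n! · binom(a, n)`). [folklore] -/
theorem factorial_dvd_prod_sub (a : ℤ) (n : ℕ) :
    (n.factorial : ℤ) ∣ ∏ j ∈ range n, (a - j) := by
  have h := Ring.descPochhammer_eq_factorial_smul_choose a n
  rw [← Polynomial.eval_eq_smeval, descPochhammer_eval_eq_prod_range] at h
  rw [h, nsmul_eq_mul]
  exact Dvd.intro _ rfl

/-- **The denominator estimate** (CDT §2.1, proof of Lemma 2.1.1: "`(1 + u)^{1/N} ∈ ℤ⟦u/N²⟧` by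
a simple denominator estimate"): for all natural numbers `N`, `n`,
`n! ∣ Nⁿ · ∏_{j<n} (1 − j N)`. [cite: CalegariDimitrovTang2025, §2.1, proof of Lemma 2.1.1] -/
theorem factorial_dvd_pow_mul_prod_one_sub_mul (N n : ℕ) :
    (n.factorial : ℤ) ∣ (N : ℤ) ^ n * ∏ j ∈ range n, (1 - (j : ℤ) * N) := by
  rcases Nat.eq_zero_or_pos n with hn | hn
  · subst hn; simp
  rcases Nat.eq_zero_or_pos N with hN | hN
  · subst hN; simp [zero_pow hn.ne']
  set P : ℤ := ∏ j ∈ range n, (1 - (j : ℤ) * N) with hP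
  -- reduce to prime powers dividing `n!`
  rw [Int.natCast_dvd, Nat.dvd_iff_prime_pow_dvd_dvd]
  intro p k hp hpk
  haveI : Fact p.Prime := ⟨hp⟩
  have hk : k ≤ padicValNat p n.factorial :=
    (padicValNat_dvd_iff_le (Nat.factorial_ne_zero n)).mp hpk
  rw [← Int.natCast_dvd]
  push_cast
  by_cases hpN : p ∣ N
  · -- `p ∣ N`: `pᵏ ∣ pⁿ ∣ Nⁿ`
    have hkn : k ≤ n := hk.trans (padicValNat_factorial_lt_of_ne_zero p hn.ne').le
    have h1 : (p : ℤ) ^ k ∣ (N : ℤ) ^ n :=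
      (pow_dvd_pow (p : ℤ) hkn).trans (pow_dvd_pow_of_dvd (Int.natCast_dvd_natCast.mpr hpN) n)
    exact h1.mul_right P
  · -- `p ∤ N`: invert `N` modulo `pᵏ`
    have hcop : Nat.Coprime N (p ^ k) :=
      (Nat.Coprime.pow_right k ((Nat.Prime.coprime_iff_not_dvd hp).mpr hpN).symm)
    obtain ⟨a, ha⟩ := Int.mod_coprime hcop
    -- `1 − jN ≡ N (a − j) (mod pᵏ)`
    have hcong : ∀ j ∈ range n, (1 - (j : ℤ) * N) ≡ (N : ℤ) * (a - j) [ZMOD (p ^ k : ℕ)] := by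
      intro j _
      have h1 : (N : ℤ) * (a - j) = (N : ℤ) * a - (j : ℤ) * N := by ring
      rw [h1]
      exact Int.ModEq.sub_right _ ha.symm
    have hPc : P ≡ ∏ j ∈ range n, (N : ℤ) * (a - j) [ZMOD (p ^ k : ℕ)] := Int.ModEq.prod hcong
    rw [prod_mul_distrib, prod_const, card_range] at hPc
    -- `pᵏ ∣ n! ∣ ∏ (a − j)`
    have hdiv : ((p ^ k : ℕ) : ℤ) ∣ (N : ℤ) ^ n * ∏ j ∈ range n, (a - (j : ℤ)) := by
      refine Dvd.dvd.mul_left ((Int.natCast_dvd_natCast.mpr hpk).trans (factorial_dvd_prod_sub a n)) _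
    have hPdiv : ((p ^ k : ℕ) : ℤ) ∣ P := by
      have h2 := Dvd.dvd.sub hdiv hPc.dvd
      simpa using h2
    push_cast at hPdiv
    exact hPdiv.mul_left _

/-! ### 2. `N^{2n} binom(1/N, n) ∈ ℤ` and `(1 + N²u)^{1/N} ∈ ℤ⟦u⟧` -/

/-- The binomial coefficient `binom(1/N, n)` as a product: `n! · binom(1/N, n) = ∏_{j<n} (1/N − j)`.
[folklore] -/
theorem factorial_mul_choose_inv_eq_prod (N n : ℕ) :
    (n.factorial : ℚ) * Ring.choose ((N : ℚ)⁻¹) n = ∏ j ∈ range n, ((N : ℚ)⁻¹ - j) := by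
  have h := Ring.descPochhammer_eq_factorial_smul_choose ((N : ℚ)⁻¹) n
  rw [← Polynomial.aeval_eq_smeval, Polynomial.aeval_def, Polynomial.eval₂_eq_eval_map,
    descPochhammer_map, descPochhammer_eval_eq_prod_range, nsmul_eq_mul] at h
  exact h.symm

/-- **`(1 + u)^{1/N} ∈ ℤ⟦u/N²⟧`** (CDT §2.1): for `N ≥ 1` and every `n`,
`N^{2n} · binom(1/N, n)` is an integer. [cite: CalegariDimitrovTang2025, §2.1, proof of
Lemma 2.1.1] -/
theorem isInt_pow_mul_choose_inv {N : ℕ} (hN : N ≠ 0) (n : ℕ) :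
    ∃ z : ℤ, (N : ℚ) ^ (2 * n) * Ring.choose ((N : ℚ)⁻¹) n = z := by
  obtain ⟨c, hc⟩ := factorial_dvd_pow_mul_prod_one_sub_mul N n
  refine ⟨c, ?_⟩
  have hfact : (n.factorial : ℚ) ≠ 0 := by exact_mod_cast n.factorial_ne_zero
  have hNq : (N : ℚ) ≠ 0 := by exact_mod_cast hN
  have hcq : (N : ℚ) ^ n * ∏ j ∈ range n, (1 - (j : ℚ) * N) = n.factorial * c := by
    exact_mod_cast hc
  have hprod : (N : ℚ) ^ n * ∏ j ∈ range n, ((N : ℚ)⁻¹ - j) = ∏ j ∈ range n, (1 - (j : ℚ) * N) := by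
    rw [← card_range n, ← prod_const, card_range, ← prod_mul_distrib]
    refine prod_congr rfl fun j _ ↦ ?_
    field_simp
  have hchoose : Ring.choose ((N : ℚ)⁻¹) n = (∏ j ∈ range n, ((N : ℚ)⁻¹ - j)) / n.factorial := by
    rw [eq_div_iff hfact, mul_comm]
    exact factorial_mul_choose_inv_eq_prod N n
  have key : (N : ℚ) ^ (2 * n) * ∏ j ∈ range n, ((N : ℚ)⁻¹ - j) = n.factorial * c := by
    rw [two_mul, pow_add, mul_assoc, hprod]
    exact hcq
  rw [hchoose, mul_div_assoc', key, mul_div_cancel_left₀ _ hfact]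

/-- The power-series form: `(1 + N² u)^{1/N} ∈ ℤ⟦u⟧`, i.e. the rescaling by `N²` of Mathlib's
binomial series `PowerSeries.binomialSeries ℚ (1/N)` has integer coefficients.
[cite: CalegariDimitrovTang2025, §2.1, proof of Lemma 2.1.1] -/
theorem binomialSeries_inv_rescale_mem_range {N : ℕ} (hN : N ≠ 0) :
    ∃ g : PowerSeries ℤ, PowerSeries.map (Int.castRingHom ℚ) g =
      PowerSeries.rescale ((N : ℚ) ^ 2) (PowerSeries.binomialSeries ℚ ((N : ℚ)⁻¹)) := by
  choose z hz using isInt_pow_mul_choose_inv hN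
  refine ⟨PowerSeries.mk z, ?_⟩
  ext n
  rw [PowerSeries.coeff_map, PowerSeries.coeff_mk, PowerSeries.coeff_rescale,
    PowerSeries.binomialSeries_coeff, smul_eq_mul, mul_one, eq_intCast, ← hz n, pow_mul]

end Literature.RingTheory.Binomial
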